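import Summits.QuantumFields.YangMills.Theorems.BalabanUVNodesN13UV01LevelZeroAtRecord13
import Literature.MathematicalPhysics.QuantumFieldTheory.Balaban1983to89.Node00.Record12BgRowHistory

/-!
# BalabanUVNodes ∕ N13 — (UV₁₃) AT LEVEL `k = 0` AT THE STAGE-13 RECORD, SIGN-FREE β-BOX EDITION: the upper half of [Balaban1989LargeFieldII] (0.1) ∕ [Balaban1988Convergent] Cor. 3 (2.50)
# at `k = 0` from the LOWER β-box `BetaLowerH (−β′) γ β₁₃` (`0 ≤ β′`) — the letter K0⁷ V18 stub 3ᴬ ∕ K2⁷'s registered pair carry («|β| ≤ β′ on ]0, γ₀]», NO SIGN) — instead of the sign floor `0 ≤ β`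

Cell `pub-ymgap` (HUMAN RULING D-0062 Track A; D-0149 width seat `pub-ymgap-dag-n13-w1`, g0, INTENT-4), key K1⁷ `StabilityBAtRecordR13SepCoPH` = stmt-QuantumFields-20542
(`--kind proof --supports … --as helper`).  Sequel of `…BalabanUVNodesN13UV01LevelZeroAtRecord13` (this seat; p586609 ∕ v1.1 p588394).  [III] = [Balaban1988Convergent], [I] = [Balaban1987RG1],
[B16] = [Balaban1989LargeFieldII].

WHY.  The sibling's level-0 UPPER bound `ρ₀ ≤ exp(ep₀(g₀)·|T^{(0)}|)` read the SIGN of the β-functions of record (`BetaLowerH b γ β₁₃`, `0 ≤ b`: the couplings do not decrease, `g₀ ≤ g_j`).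
dag-n24-w1 located (INBOX l.24571) that the END road of K1⁷ reads only that sign — but K0⁷'s stub 3ᴬ (`AbsBetaBoxAtThm1WitnessCCMAt`) and K2⁷'s registered pair deliver the box
`BetaLowerH (−β′) γ₀ β ∧ BetaUpperH β′ γ₀ β` WITHOUT a sign ([I] §1 p.264 «uniformly bounded»; the sign = (discrete) asymptotic freedom, [I] Thm 2, unpublished [B16] p.355).  At level 0
the sign is NOT needed: from (0.20) `g_{j+1}⁻² = g_j⁻² − β_j` and `β_j ≥ −β′` one gets `g_j⁻² ≤ g₀⁻² + j·β′`, hence `log g_j⁻¹ ≤ log g₀⁻¹ + j·β′∕2` (`log x ≤ x − 1`, `g₀ ≤ 1`), and the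
extra `j` is summable against `|T^{(j)*}| = 4(|T^{(j)}| − |T^{(j+1)}|) ≤ 4|T^{(0)}|∕L^{4j}`: `Σ_{j<K} j·|T^{(j)*}| ≤ 8·|T^{(0)}|`.

WHAT THIS FILE PROVES (theorems only, 0 `def`).
§1 `inv_sq_genSeq_le_add_mul_of_betaLowerH_neg` (`(g_j²)⁻¹ ≤ (g₀²)⁻¹ + j·β′`, `j ≤ K`, generic `β : HBeta`), `log_inv_le_log_inv_add_of_inv_sq_le` (the log step).
§2 `sitesCard_P_eq_div_pow` (`|T^{(j)}| = |T^{(0)}|∕(L⁴)^j`), `mul_tstarCount_P_le` (`j·|T^{(j)*}| ≤ 4·|T^{(0)}|·(⅛)^j`, `L ≥ 2`), ★ `sum_mul_tstarCount_P_range_le` (`Σ_{j<K} j·|T^{(j)*}| ≤ 8·|T^{(0)}|`).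
§3 ★ `neg_EOfRecord₁₃_le_of_inInterval_of_betaLowerH_neg` (`−E ≤ 4·(d(𝔤)·(log g₀⁻¹ + β′) + max(−log σ₀,0))·|T^{(0)}|` at `Efl = logz = 0`), ★★ `uv_zero_densOfRecord₁₃_of_Efl_logz_of_inInterval_of_betaLowerH_neg`
   (BOTH sides at `k = 0`, engines' currency: `em₀(g) = 4·max(log σ₀,0) + 12·g⁻²` unchanged, `ep₀′(g) = 4·(d(𝔤)·(log g⁻¹ + β′) + max(−log σ₀,0))`), `hUV_of_succ_of_dom_of_betaLowerH_neg` (the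
   sibling's §5 reduction of the engines' ∀k row `hUV` to its levels `k ≥ 1`, sign-free); §3b the datum form `uvIneq_zero_datumOfRecord₁₃CoPH_…_of_betaLowerH_neg` (`B16.UVIneq`).

HONEST FRAMING.  LEVEL `k = 0` ONLY (`ρ₀` explicit — no estimate of Bałaban's is used or asserted); the β-box lower half, the window `γ ≤ 1` and `Efl = logz = 0` are DISPLAYED hypotheses;
levels `k ≥ 1` of (UV₁₃) = [B16] Thm 1 + Cor. 3 proper, untouched and UNOWNED; N13 NOT discharged; count-neutral helper; one finite `𝕋⁴_{L^K}` programme at fixed `ε = L^{−K}` — NOT a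
continuum ∕ ℝ⁴ ∕ OS ∕ mass-gap ∕ Clay statement.  No `def`, no `sorry`, no `instance`.
-/

noncomputable section

open scoped BigOperators

namespace Summit.QuantumFields.YangMills.BalabanUVNodes.N13UV01LevelZeroAtRecord13SignFree

open Literature.MathematicalPhysics.QuantumFieldTheory.Balaban1983to89
open Literature.MathematicalPhysics.QuantumFieldTheory.Balaban1983to89.T4Continuum
open Literature.MathematicalPhysics.QuantumFieldTheory.Balaban1983to89.Node00
open Literature.MathematicalPhysics.QuantumFieldTheory.Balaban1983to89.FlowStepRuns (genFlow genSeq genSeq_zero)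
open Literature.MathematicalPhysics.QuantumFieldTheory.Balaban1983to89.FlowStep (HBeta prefixOf Box mem_box BetaLowerH)
open Literature.MathematicalPhysics.QuantumFieldTheory.Balaban1983to89.B10Eq41TorusHistories (card_site_mul_pow)
open Summit.QuantumFields.YangMills.BalabanUVNodes.N13UV01LevelZeroAtRecord13

variable {F : T4Family} {N : ℕ} [NeZero N]

/-! ## §1 The coupling flow under the LOWER β-box only: `g_j⁻² ≤ g₀⁻² + j·β′` and the logarithmic step -/

/-- **`(g_j²)⁻¹ ≤ (g₀²)⁻¹ + j·β′` FOR `j ≤ K` ALONG A WINDOWED HISTORY WITH `β ≥ −β′` ON THE γ-BOX** — (0.20) `g_{j+1}⁻² = g_j⁻² − β_j(g₀,…,g_j)` (`Node00.inv_sq_genSeq_succ`) iterated; no sign of β is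
used. [I] (0.20) p.256, §1 p.264; [III] (2.6) p.255. -/
theorem inv_sq_genSeq_le_add_mul_of_betaLowerH_neg (β : HBeta) (g0 : ℝ) {γ β' : ℝ} {K : ℕ} (hβ : BetaLowerH (-β') γ β)
    (hI : Step.InInterval γ K (genSeq β g0)) :
    ∀ j, j ≤ K → ((genSeq β g0 j) ^ 2)⁻¹ ≤ ((genSeq β g0 0) ^ 2)⁻¹ + j * β' := by
  intro j
  induction j with
  | zero => intro _; simp
  | succ j ih =>
    intro hj
    have hprev := ih (Nat.le_of_succ_le hj)
    have hstep := inv_sq_genSeq_succ β g0 (hI (j + 1) hj).1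
    have hbox : prefixOf (genSeq β g0) j ∈ Box γ j := mem_box.mpr fun i => hI i (by have := i.isLt; omega)
    have hb : -β' ≤ β j (prefixOf (genSeq β g0) j) := hβ j _ hbox
    rw [hstep]
    push_cast
    linarith

/-- **THE LOGARITHMIC STEP**: `0 < g₀ ≤ 1`, `0 < g`, `(g²)⁻¹ ≤ (g₀²)⁻¹ + t`, `0 ≤ t` ⇒ `log g⁻¹ ≤ log g₀⁻¹ + t∕2` (`log x ≤ x − 1` at `x = g₀²∕g²`, and `g₀² ≤ 1`). Elementary. -/
theorem log_inv_le_log_inv_add_of_inv_sq_le {g g0 t : ℝ} (hg : 0 < g) (hg0 : 0 < g0) (hg0' : g0 ≤ 1) (ht : 0 ≤ t)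
    (h : (g ^ 2)⁻¹ ≤ (g0 ^ 2)⁻¹ + t) : Real.log g⁻¹ ≤ Real.log g0⁻¹ + t / 2 := by
  have hg2 : 0 < g ^ 2 := pow_pos hg 2
  have hg02 : 0 < g0 ^ 2 := pow_pos hg0 2
  have hx : 0 < (g ^ 2)⁻¹ / (g0 ^ 2)⁻¹ := div_pos (inv_pos.mpr hg2) (inv_pos.mpr hg02)
  -- log (g²)⁻¹ − log (g₀²)⁻¹ ≤ (g²)⁻¹/(g₀²)⁻¹ − 1 = g₀²·((g²)⁻¹ − (g₀²)⁻¹) ≤ g₀²·t ≤ t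
  have hlog : Real.log (g ^ 2)⁻¹ - Real.log (g0 ^ 2)⁻¹ ≤ t := by
    rw [← Real.log_div (inv_pos.mpr hg2).ne' (inv_pos.mpr hg02).ne']
    refine (Real.log_le_sub_one_of_pos hx).trans ?_
    have h1 : (g ^ 2)⁻¹ / (g0 ^ 2)⁻¹ - 1 = g0 ^ 2 * ((g ^ 2)⁻¹ - (g0 ^ 2)⁻¹) := by
      field_simp
    rw [h1]
    have h2 : (g ^ 2)⁻¹ - (g0 ^ 2)⁻¹ ≤ t := by linarith
    have h3 : g0 ^ 2 ≤ 1 := by nlinarith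
    calc g0 ^ 2 * ((g ^ 2)⁻¹ - (g0 ^ 2)⁻¹) ≤ g0 ^ 2 * t := mul_le_mul_of_nonneg_left h2 hg02.le
      _ ≤ 1 * t := mul_le_mul_of_nonneg_right h3 ht
      _ = t := one_mul t
  have e1 : Real.log (g ^ 2)⁻¹ = 2 * Real.log g⁻¹ := by
    rw [Real.log_inv, Real.log_inv, Real.log_pow]; push_cast; ring
  have e2 : Real.log (g0 ^ 2)⁻¹ = 2 * Real.log g0⁻¹ := by
    rw [Real.log_inv, Real.log_inv, Real.log_pow]; push_cast; ring
  rw [e1, e2] at hlog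
  linarith

/-! ## §2 The weighted count `Σ_{j<K} j·|T^{(j)*}| ≤ 8·|T^{(0)}|` on Bałaban's four-dimensional tori -/

/-- **`|T^{(j)}| = |T^{(0)}| ∕ (L⁴)^j` in the standing range `j ≤ m + K`** (`B10Eq41TorusHistories.card_site_mul_pow`, `d = 4`). [I] (0.1) p.251. -/
theorem sitesCard_P_eq_div_pow {K j : ℕ} (hj : j ≤ F.m + K) :
    (Fintype.card (Site (F.P K) j) : ℝ) = (Fintype.card (Site (F.P K) 0) : ℝ) / (((F.L : ℝ) ^ 4) ^ j) := by
  have h := card_site_mul_pow (P := F.P K) (j := j) (by simpa using hj)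
  have hL : (0 : ℝ) < ((F.L : ℝ) ^ 4) ^ j := by
    have := F.hL.2; positivity
  rw [eq_div_iff hL.ne']
  have h' : ((Fintype.card (Site (F.P K) j) * ((F.P K).L ^ (F.P K).d) ^ j : ℕ) : ℝ) = (Fintype.card (Site (F.P K) 0) : ℝ) := by
    exact_mod_cast h
  simpa using h'

/-- **`j·|T^{(j)*}| ≤ 4·|T^{(0)}|·(⅛)^j`** for `j + 1 ≤ m + K` (`|T^{(j)*}| ≤ 4|T^{(j)}| = 4|T^{(0)}|∕(L⁴)^j`, `j ≤ 2^j`, `L⁴ ≥ 16`). [III] (1.15) p.249 (bookkeeping). -/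
theorem mul_tstarCount_P_le {K j : ℕ} (hj : j + 1 ≤ F.m + K) :
    (j : ℝ) * tstarCount (F.P K) j ≤ 4 * (Fintype.card (Site (F.P K) 0) : ℝ) * (1 / 8 : ℝ) ^ j := by
  have hs0 : 0 ≤ (Fintype.card (Site (F.P K) 0) : ℝ) := Nat.cast_nonneg _
  have hs1 : 0 ≤ (Fintype.card (Site (F.P K) (j + 1)) : ℝ) := Nat.cast_nonneg _
  have hL2 : (2 : ℝ) ≤ F.L := by exact_mod_cast F.hL.2
  have hL16 : (16 : ℝ) ≤ (F.L : ℝ) ^ 4 := by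
    have h := pow_le_pow_left₀ (by norm_num : (0 : ℝ) ≤ 2) hL2 4
    norm_num at h
    exact h
  have hj0 : (0 : ℝ) ≤ j := Nat.cast_nonneg _
  -- `T*_j ≤ 4·s_j = 4·s_0/(L⁴)^j`
  have hT : tstarCount (F.P K) j ≤ 4 * ((Fintype.card (Site (F.P K) 0) : ℝ) / (((F.L : ℝ) ^ 4) ^ j)) := by
    unfold tstarCount sitesCard
    rw [sitesCard_P_eq_div_pow (Nat.le_of_succ_le hj)]
    have : 0 ≤ 4 * (Fintype.card (Site (F.P K) (j + 1)) : ℝ) := by positivity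
    linarith
  -- `j/(L⁴)^j ≤ 2^j/16^j = (⅛)^j`
  have hpow : (0 : ℝ) < ((F.L : ℝ) ^ 4) ^ j := by positivity
  have hj2 : (j : ℝ) ≤ (2 : ℝ) ^ j := by exact_mod_cast Nat.lt_two_pow_self.le
  have h16 : (16 : ℝ) ^ j ≤ ((F.L : ℝ) ^ 4) ^ j := pow_le_pow_left₀ (by norm_num) hL16 j
  calc (j : ℝ) * tstarCount (F.P K) j
      ≤ (j : ℝ) * (4 * ((Fintype.card (Site (F.P K) 0) : ℝ) / (((F.L : ℝ) ^ 4) ^ j))) := mul_le_mul_of_nonneg_left hT hj0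
    _ = 4 * (Fintype.card (Site (F.P K) 0) : ℝ) * ((j : ℝ) / (((F.L : ℝ) ^ 4) ^ j)) := by ring
    _ ≤ 4 * (Fintype.card (Site (F.P K) 0) : ℝ) * ((2 : ℝ) ^ j / (16 : ℝ) ^ j) := by
        apply mul_le_mul_of_nonneg_left _ (by positivity)
        exact div_le_div₀ (by positivity) hj2 (by positivity) h16
    _ = 4 * (Fintype.card (Site (F.P K) 0) : ℝ) * (1 / 8 : ℝ) ^ j := by
        rw [← div_pow]; norm_num

/-- **★ `Σ_{j<K} j·|T^{(j)*}| ≤ 8·|T^{(0)}|`** on the `K`-th torus (`Σ_j (⅛)^j ≤ 8∕7 ≤ 2`, Mathlib's `geom_sum_Ico_le_of_lt_one`). [III] (1.15) p.249; p.262 (bookkeeping). -/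
theorem sum_mul_tstarCount_P_range_le (K : ℕ) :
    ∑ j ∈ Finset.range K, (j : ℝ) * tstarCount (F.P K) j ≤ 8 * (Fintype.card (Site (F.P K) 0) : ℝ) := by
  have hs0 : 0 ≤ (Fintype.card (Site (F.P K) 0) : ℝ) := Nat.cast_nonneg _
  have hstep : ∀ j ∈ Finset.range K, (j : ℝ) * tstarCount (F.P K) j ≤ 4 * (Fintype.card (Site (F.P K) 0) : ℝ) * (1 / 8 : ℝ) ^ j :=
    fun j hj => mul_tstarCount_P_le (by have := Finset.mem_range.mp hj; omega)
  refine (Finset.sum_le_sum hstep).trans ?_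
  rw [← Finset.mul_sum]
  have hgeom : ∑ j ∈ Finset.range K, (1 / 8 : ℝ) ^ j ≤ 2 := by
    rw [Finset.range_eq_Ico]
    refine (geom_sum_Ico_le_of_lt_one (by norm_num) (by norm_num)).trans ?_
    norm_num
  calc 4 * (Fintype.card (Site (F.P K) 0) : ℝ) * ∑ j ∈ Finset.range K, (1 / 8 : ℝ) ^ j
      ≤ 4 * (Fintype.card (Site (F.P K) 0) : ℝ) * 2 := mul_le_mul_of_nonneg_left hgeom (by positivity)
    _ = 8 * (Fintype.card (Site (F.P K) 0) : ℝ) := by ring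

/-! ## §3 ★ The level-`0` bounds with the SIGN-FREE lower β-box -/

section SignFree

variable (θ : Stage13Params F N) (P : B12.RunParams)

/-- **★ `−E(P) ≤ 4·(d(𝔤)·(log g₀⁻¹ + β′) + max(−log σ₀, 0))·|T^{(0)}|` ALONG A WINDOWED RUN WITH `β₁₃ ≥ −β′` ON THE γ-BOX** (`0 ≤ β′`, `γ ≤ 1`), at `Efl = logz = 0`: the sibling's
`neg_EOfRecord₁₃_le_of_inInterval_of_betaLowerH` WITHOUT the sign of β (`log g_j⁻¹ ≤ log g₀⁻¹ + j·β′∕2` by §1, `Σ_j j·|T^{(j)*}| ≤ 8|T^{(0)}|` by §2). [III] Thm 1 p.262, (1.15) p.249; [I] (0.20) p.256, §1 p.264. -/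
theorem neg_EOfRecord₁₃_le_of_inInterval_of_betaLowerH_neg (hEfl : ∀ j, θ.Efl P j = 0) (hlogz : ∀ j, θ.logz P j = 0) {γ β' : ℝ} (hγ : γ ≤ 1) (hβ' : 0 ≤ β')
    (hβ : BetaLowerH (-β') γ (betaOfRecord₁₃ F N θ)) (hI : (genFlow (betaOfRecord₁₃ F N θ) P.g0).InInterval γ P.K) :
    -(EOfRecord₁₃ F N θ P) ≤ 4 * ((dimSU N : ℕ) * (Real.log P.g0⁻¹ + β') + max (-θ.ν.logσ₀) 0) * (Fintype.card (Site (F.P P.K) 0) : ℝ) := by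
  rw [EOfRecord₁₃_eq_sum_of_Efl_logz θ P hEfl hlogz, ← Finset.sum_neg_distrib]
  have hI' : Step.InInterval γ P.K (gOfRecord₁₃ F N θ P) := fun k hk => hI k hk
  have hg0 := hI 0 (Nat.zero_le _)
  have hg0eq : gOfRecord₁₃ F N θ P 0 = P.g0 := genSeq_zero _ _
  have hg0pos : 0 < P.g0 := hg0eq ▸ hg0.1
  have hg0le : P.g0 ≤ 1 := hg0eq ▸ (hg0.2.trans hγ)
  have hlog0 : 0 ≤ Real.log P.g0⁻¹ := Real.log_nonneg (one_le_inv_iff₀.mpr ⟨hg0pos, hg0le⟩)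
  have hd : (0 : ℝ) ≤ (dimSU N : ℕ) := Nat.cast_nonneg _
  have hinv := inv_sq_genSeq_le_add_mul_of_betaLowerH_neg (betaOfRecord₁₃ F N θ) P.g0 hβ hI'
  -- per level: `−e_j ≤ (d·log g₀⁻¹ + M)·T*_j + (d·β′/2)·(j·T*_j)`
  have hstep : ∀ j ∈ Finset.range P.K,
      -((Real.log (gOfRecord₁₃ F N θ P j) * (dimSU N : ℕ) + θ.ν.logσ₀) * tstarCount (F.P P.K) j)
        ≤ ((dimSU N : ℕ) * Real.log P.g0⁻¹ + max (-θ.ν.logσ₀) 0) * tstarCount (F.P P.K) j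
          + ((dimSU N : ℕ) * β' / 2) * ((j : ℝ) * tstarCount (F.P P.K) j) := by
    intro j hj
    have hjK : j < P.K := Finset.mem_range.mp hj
    have hT : 0 ≤ tstarCount (F.P P.K) j := tstarCount_P_nonneg (by simp; omega)
    have hgj := hI j hjK.le
    have hlog : Real.log (gOfRecord₁₃ F N θ P j)⁻¹ ≤ Real.log P.g0⁻¹ + (j * β') / 2 := by
      refine log_inv_le_log_inv_add_of_inv_sq_le hgj.1 hg0pos hg0le (mul_nonneg (Nat.cast_nonneg j) hβ') ?_
      have := hinv j hjK.le
      rw [genSeq_zero] at this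
      exact this
    have hlog' : -Real.log (gOfRecord₁₃ F N θ P j) ≤ Real.log P.g0⁻¹ + (j * β') / 2 := by rwa [Real.log_inv] at hlog
    have h1 : -(Real.log (gOfRecord₁₃ F N θ P j) * (dimSU N : ℕ) + θ.ν.logσ₀)
        ≤ (dimSU N : ℕ) * Real.log P.g0⁻¹ + max (-θ.ν.logσ₀) 0 + ((dimSU N : ℕ) * β' / 2) * j := by
      have := mul_le_mul_of_nonneg_right hlog' hd
      nlinarith [le_max_left (-θ.ν.logσ₀) 0, this]
    have := mul_le_mul_of_nonneg_right h1 hT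
    nlinarith [this]
  refine (Finset.sum_le_sum hstep).trans ?_
  rw [Finset.sum_add_distrib, ← Finset.mul_sum, ← Finset.mul_sum]
  have hm : 0 ≤ (dimSU N : ℕ) * Real.log P.g0⁻¹ + max (-θ.ν.logσ₀) 0 := by
    have := mul_nonneg hd hlog0
    linarith [le_max_right (-θ.ν.logσ₀) 0]
  have hA := mul_le_mul_of_nonneg_left (sum_tstarCount_P_range_le (F := F) P.K P.K) hm
  have hB := mul_le_mul_of_nonneg_left (sum_mul_tstarCount_P_range_le (F := F) P.K) (by positivity : (0 : ℝ) ≤ (dimSU N : ℕ) * β' / 2)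
  have hs0 : 0 ≤ (Fintype.card (Site (F.P P.K) 0) : ℝ) := Nat.cast_nonneg _
  nlinarith [hA, hB, mul_nonneg hd hβ', hs0]

/-- **★★ THE LEVEL-`0` CONJUNCT OF N13's (UV₁₃) ROW, BOTH SIDES, SIGN-FREE β-BOX** — at every Stage-13 parameter with `Efl = logz = 0`, along every run in `]0, γ]`, `γ ≤ 1`, whose β-functions of record
are `≥ −β′` on the γ-box (`0 ≤ β′`): `χβ₀·exp(−g₀⁻²·A^η₀ − em₀(g₀)·|T^{(0)}|) ≤ ρ₀ ≤ exp(ep₀′(g₀)·|T^{(0)}|)` with `em₀(g) = 4·max(log σ₀,0) + 12·g⁻²` (the sibling's, β-free) and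
`ep₀′(g) = 4·(d(𝔤)·(log g⁻¹ + β′) + max(−log σ₀,0))` — functions of `g₀ = gOfRecord₁₃ θ P 0` alone.  Engines' currency (`…N12AtRecord13SepCoPHSockets` :129 at `k = 0`).
[B16] (0.1) pp.355–356; [III] Cor. 3 (2.50) p.264, Thm 1 p.262, (1.15) p.249; [I] (0.20) p.256, §1 p.264. -/
theorem uv_zero_densOfRecord₁₃_of_Efl_logz_of_inInterval_of_betaLowerH_neg (hEfl : ∀ j, θ.Efl P j = 0) (hlogz : ∀ j, θ.logz P j = 0)
    {γ β' : ℝ} (hγ : γ ≤ 1) (hβ' : 0 ≤ β') (hβ : BetaLowerH (-β') γ (betaOfRecord₁₃ F N θ)) (hI : (genFlow (betaOfRecord₁₃ F N θ) P.g0).InInterval γ P.K)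
    (U : GaugeField (F.P P.K) 0 (SU N)) :
    chiβOfRecord₁₃ F N θ P.K (gOfRecord₁₃ F N θ P) 0 U *
          Real.exp (-(1 / (gOfRecord₁₃ F N θ P 0)) ^ 2 * wilsonBGOfRecord F N θ.εbg P 0 U
            - (4 * max θ.ν.logσ₀ 0 + 12 * (1 / gOfRecord₁₃ F N θ P 0) ^ 2) * (Fintype.card (Site (F.P P.K) 0) : ℝ)) ≤ densOfRecord₁₃ F N θ P 0 U ∧
      densOfRecord₁₃ F N θ P 0 U ≤
        Real.exp (4 * ((dimSU N : ℕ) * (Real.log (gOfRecord₁₃ F N θ P 0)⁻¹ + β') + max (-θ.ν.logσ₀) 0) * (Fintype.card (Site (F.P P.K) 0) : ℝ)) := by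
  have hg0 : gOfRecord₁₃ F N θ P 0 = P.g0 := genSeq_zero _ _
  refine ⟨?_, ?_⟩
  · have h := uv_lower_zero_of_E_le θ P (EOfRecord₁₃_le_of_inInterval θ P hEfl hlogz hγ hI) U
    rw [hg0] at h ⊢
    exact h
  · rw [hg0]
    exact uv_upper_zero_of_negE_le θ P (neg_EOfRecord₁₃_le_of_inInterval_of_betaLowerH_neg θ P hEfl hlogz hγ hβ' hβ hI) U

end SignFree

/-! ## §3b The datum form, sign-free: `B16.UVIneq` at `(datumOfRecord₁₃CoPH θ h).C P`, level `0` -/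

section Datum

variable (θ : Stage13HParams F N) (h : θ.Provisos₁₃CoPH F N) (P : B12.RunParams)

/-- **(0.1) ∕ (2.50) AT LEVEL `0` AT THE CONSTRUCTION OF RECORD, SIGN-FREE β-BOX**, in [B16]'s own carrier `B16.UVIneq` with `E₋ = em₀(g₀)`, `E₊ = ep₀′(g₀)` — through dag-n24-c's
`B16NodeKnitRecord13CoPH.uvIneq_at_record₁₃CoPH_iff` (the tree's two (0.1) currencies bridged by `ring`). [B16] (0.1) p.356; [III] (2.50) p.264. -/
theorem uvIneq_zero_datumOfRecord₁₃CoPH_of_Efl_logz_of_inInterval_of_betaLowerH_neg (hEfl : ∀ j, θ.Efl P j = 0) (hlogz : ∀ j, θ.logz P j = 0)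
    {γ β' : ℝ} (hγ : γ ≤ 1) (hβ' : 0 ≤ β') (hβ : BetaLowerH (-β') γ (betaOfRecord₁₃ F N θ.toStage13Params))
    (hI : (genFlow (betaOfRecord₁₃ F N θ.toStage13Params) P.g0).InInterval γ P.K) (V : GaugeField (F.P P.K) 0 (SU N)) :
    B16.UVIneq ((datumOfRecord₁₃CoPH F N θ h).C P) 0 V
      (4 * max θ.ν.logσ₀ 0 + 12 * (1 / gOfRecord₁₃ F N θ.toStage13Params P 0) ^ 2)
      (4 * ((dimSU N : ℕ) * (Real.log (gOfRecord₁₃ F N θ.toStage13Params P 0)⁻¹ + β') + max (-θ.ν.logσ₀) 0)) := by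
  have h0 := uv_zero_densOfRecord₁₃_of_Efl_logz_of_inInterval_of_betaLowerH_neg θ.toStage13Params P hEfl hlogz hγ hβ' hβ hI V
  refine (B16NodeKnitRecord13CoPH.uvIneq_at_record₁₃CoPH_iff F N θ h P 0 V _ _).mpr ⟨?_, h0.2⟩
  convert h0.1 using 3
  ring

end Datum

/-! ## §4 The engines' ∀k row `hUV` reduced to its levels `k ≥ 1`, sign-free β-box -/

section Reduce

variable (θ : Stage13HParams F N)

/-- **`hUV` ⟸ (its levels `k ≥ 1`) + DOMINATION AT LEVEL `0`, SIGN-FREE β-BOX** — the sibling's `hUV_of_succ_of_dom` with `BetaLowerH b γ β₁₃, 0 ≤ b` replaced by `BetaLowerH (−β′) γ β₁₃,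
0 ≤ β′` and `ep₀ ↦ ep₀′`.  The engines' (UV₁₃) hypothesis VERBATIM in the conclusion. [B16] (0.1) pp.355–356; [III] Cor. 3 (2.50) p.264; [I] (0.20) p.256, §1 p.264. -/
theorem hUV_of_succ_of_dom_of_betaLowerH_neg (hEfl : ∀ P j, θ.Efl P j = 0) (hlogz : ∀ P j, θ.logz P j = 0) (em ep : ℝ → ℝ) {γ β' : ℝ} (hγ : γ ≤ 1)
    (hβ' : 0 ≤ β') (hβ : BetaLowerH (-β') γ (betaOfRecord₁₃ F N θ.toStage13Params))
    (hdom : ∀ g : ℝ, 0 < g → g ≤ γ →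
      4 * max θ.ν.logσ₀ 0 + 12 * (1 / g) ^ 2 ≤ em g ∧ 4 * ((dimSU N : ℕ) * (Real.log g⁻¹ + β') + max (-θ.ν.logσ₀) 0) ≤ ep g)
    (hsucc : ∀ P : B12.RunParams, (genFlow (betaOfRecord₁₃ F N θ.toStage13Params) P.g0).InInterval γ P.K → ∀ k, k + 1 ≤ P.K → SLaw₁₃CoPH F N θ P (k + 1) →
      ∀ U : GaugeField (F.P P.K) (k + 1) (SU N),
        chiβOfRecord₁₃ F N θ.toStage13Params P.K (gOfRecord₁₃ F N θ.toStage13Params P) (k + 1) U *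
              Real.exp (-(1 / (gOfRecord₁₃ F N θ.toStage13Params P (k + 1))) ^ 2 * wilsonBGOfRecord F N θ.toStage13Params.εbg P (k + 1) U
                - em (gOfRecord₁₃ F N θ.toStage13Params P (k + 1)) * (Fintype.card (Site (F.P P.K) (k + 1)) : ℝ)) ≤ densOfRecord₁₃ F N θ.toStage13Params P (k + 1) U ∧
        densOfRecord₁₃ F N θ.toStage13Params P (k + 1) U ≤ Real.exp (ep (gOfRecord₁₃ F N θ.toStage13Params P (k + 1)) * (Fintype.card (Site (F.P P.K) (k + 1)) : ℝ))) :
    ∀ P : B12.RunParams, (genFlow (betaOfRecord₁₃ F N θ.toStage13Params) P.g0).InInterval γ P.K → ∀ k, k ≤ P.K → SLaw₁₃CoPH F N θ P k →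
      ∀ U : GaugeField (F.P P.K) k (SU N),
        chiβOfRecord₁₃ F N θ.toStage13Params P.K (gOfRecord₁₃ F N θ.toStage13Params P) k U *
              Real.exp (-(1 / (gOfRecord₁₃ F N θ.toStage13Params P k)) ^ 2 * wilsonBGOfRecord F N θ.toStage13Params.εbg P k U
                - em (gOfRecord₁₃ F N θ.toStage13Params P k) * (Fintype.card (Site (F.P P.K) k) : ℝ)) ≤ densOfRecord₁₃ F N θ.toStage13Params P k U ∧
        densOfRecord₁₃ F N θ.toStage13Params P k U ≤ Real.exp (ep (gOfRecord₁₃ F N θ.toStage13Params P k) * (Fintype.card (Site (F.P P.K) k) : ℝ)) := by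
  intro P hI k hk hS U
  cases k with
  | succ k => exact hsucc P hI k hk hS U
  | zero =>
    have h0 := uv_zero_densOfRecord₁₃_of_Efl_logz_of_inInterval_of_betaLowerH_neg θ.toStage13Params P (hEfl P) (hlogz P) hγ hβ' hβ hI U
    have hg := hI 0 (Nat.zero_le _)
    have hd := hdom (gOfRecord₁₃ F N θ.toStage13Params P 0) hg.1 hg.2
    have hcard : 0 ≤ (Fintype.card (Site (F.P P.K) 0) : ℝ) := Nat.cast_nonneg _
    have hχ0 : 0 ≤ chiβOfRecord₁₃ F N θ.toStage13Params P.K (gOfRecord₁₃ F N θ.toStage13Params P) 0 U :=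
      (chiFix29OfRecord_mem_Icc (F := F) (N := N) θ.ν θ.ε₂₉ P.K 0 U).1
    refine ⟨?_, h0.2.trans (Real.exp_le_exp.mpr (mul_le_mul_of_nonneg_right hd.2 hcard))⟩
    refine le_trans (mul_le_mul_of_nonneg_left (Real.exp_le_exp.mpr ?_) hχ0) h0.1
    have := mul_le_mul_of_nonneg_right hd.1 hcard
    linarith

end Reduce

end Summit.QuantumFields.YangMills.BalabanUVNodes.N13UV01LevelZeroAtRecord13SignFree
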